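import Summits.Parity.GeneralizedHardyLittlewood.Theorems.LeeYangFibresRelativeDimOneAmplificationAux
import Summits.Parity.GeneralizedHardyLittlewood.Theorems.LeeYangFibresRelativeDimOneTightness
import Summits.Parity.GeneralizedHardyLittlewood.Theorems.LeeYangFibresRelativeDimOne
import Summits.Parity.GeneralizedHardyLittlewood.Theorems.LeeYangFibresCellParityLawSingularRatio
import HarnessLib

/-!
# Route `LeeYangFibres`, crux `RelativeDimOne` (stmt-Parity-14113), line `SketchIdeator1` =
`translate-amplification`: THE TRANSFER `stub_amplification`

The registered stub `stub_amplification : Amplification`, i.e.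

`CompleteSum → SingularMean → DegenerateCount → CoarseHLSlack → RelativeDimOne`:

complete sums over translate-constellations + averaged main terms + few degenerate shifts turn the
atom `CoarseHLSlack` (two-sided order-of-magnitude bounds for prime constellations with
sub-exponential loss `e^{±g(T)}`, `g(T)/T → 0`, and `o(N)` slack) into the crux (relative accuracy
`ε`). This is the tensor-power trick.

Given `t ≥ 1`, `L`, `ε > 0`, put `e = min ε 1` and `S = S(Ψ,K,N)`, `M = β_∞(Ψ,K) 𝔖(Ψ) ≥ 0`.

* The number of translates: `g(T)/T → 0` gives `m ≥ 1` with `|g((m+1)t)| ≤ (m+1) log(1 + e/4)`, so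
  the losses at dimension `T = (m+1)t` are `e^{g(T)} ≤ A`, `e^{-g(T)} ≥ A⁻¹`, `A = (1+e/4)^{m+1}`.
* LOW MASS `M < κN`, `κ = e / (4 max(1, e^{g(t)}))`: the atom at dimension `t` with slack `e/4` gives
  `S ≤ e^{g(t)} M + eN/4 ≤ eN/2`, and `|S - M| ≤ max(S, M) ≤ ε(M + N)`.
* HIGH MASS `M ≥ κN`: `S^{m+1} = ∑_{H ∈ [-2N,2N]^m} S(Ψ^{(H)}, K_H)` (`CompleteSum`); on the
  non-degenerate shifts the atom at dimension `T` (size `‖Ψ^{(H)}‖_N ≤ (3m+1) max(L,1)`, convex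
  `K_H ⊆ [-N,N]`) gives `A⁻¹ M_H - η'N ≤ S_H ≤ A M_H + η'N`, and `∑_{nondeg} M_H =
  M^{m+1} + O(ε₅ (M^{m+1} + N^{m+1}))` (`SingularMean`); the `≤ C (4N+1)^{m-1}` degenerate shifts
  (`DegenerateCount`) carry `S_H ≤ (2N+1) log^T(2L'N)`, in total `o(N^{m+1})`. With
  `N^{m+1} ≤ M^{m+1}/κ^{m+1}` and `ε₅, η'` small this is
  `((1-e/2)M)^{m+1} ≤ S^{m+1} ≤ ((1+e/2)M)^{m+1}`, whence `|S - M| ≤ eM/2 ≤ ε(M+N)`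
  (`high_mass_amplify` in the `Aux` file does this bookkeeping).

References: Green–Tao, Ann. of Math. 171 (2010), Conj. 1.2/1.4 [GreenTao2010]; Tao–Vu, *Additive
Combinatorics*, §2 (tensor power trick).
-/

noncomputable section

open scoped BigOperators Classical Topology
open Finset Filter MeasureTheory Literature.NumberTheory.Sieve
open Summit.Parity.GeneralizedHardyLittlewood.Theses.LeeYangFibres (RelativeDimOne)

namespace Summit.Parity.GeneralizedHardyLittlewood.Cruxes.RelativeDimOne.TranslateAmplification

set_option maxHeartbeats 400000 in
/-- **THE TRANSFER** (registered stub `stub_amplification` of line `SketchIdeator1`): complete sums +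
averaged main terms + few degenerate shifts turn the atom `CoarseHLSlack` into the crux
`RelativeDimOne` (the tensor-power trick over translate-constellations; see the module docstring
for the parameter schedule). -/
theorem stub_amplification : Amplification := by
  intro hCS hSM hD hA
  obtain ⟨g, hg, hA⟩ := hA
  intro t L ht ε hε
  -- `e = min ε 1`
  obtain ⟨e, he⟩ : ∃ e : ℝ, e = min ε 1 := ⟨_, rfl⟩
  have he0 : 0 < e := by rw [he]; exact lt_min hε one_pos
  have he1 : e ≤ 1 := by rw [he]; exact min_le_right _ _
  have heε : e ≤ ε := by rw [he]; exact min_le_left _ _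
  -- the number `m` of translates, from `g(T)/T → 0`
  have ht0 : (0 : ℝ) < t := by exact_mod_cast ht
  have ha0 : (0 : ℝ) < 1 + e / 4 := by positivity
  have hc : 0 < Real.log (1 + e / 4) / t := div_pos (Real.log_pos (by linarith)) ht0
  obtain ⟨M₀, hM₀⟩ := exists_abs_le_mul_of_tendsto_div hg hc
  obtain ⟨m, hmM, hm1⟩ : ∃ m : ℕ, M₀ ≤ m ∧ 1 ≤ m := ⟨max M₀ 1, le_max_left _ _, le_max_right _ _⟩
  have hT1 : 1 ≤ (m + 1) * t := le_trans ht (Nat.le_mul_of_pos_left t (Nat.succ_pos m))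
  obtain ⟨A, hAdef⟩ : ∃ A : ℝ, A = (1 + e / 4) ^ (m + 1) := ⟨_, rfl⟩
  have hA1 : 1 ≤ A := by rw [hAdef]; exact one_le_pow₀ (by linarith)
  have hgT : |g ((m + 1) * t)| ≤ ((m + 1 : ℕ) : ℝ) * Real.log (1 + e / 4) := by
    have h1 : M₀ ≤ (m + 1) * t :=
      le_trans hmM (le_trans (Nat.le_succ m) (Nat.le_mul_of_pos_right _ ht))
    calc |g ((m + 1) * t)| ≤ Real.log (1 + e / 4) / t * (((m + 1) * t : ℕ) : ℝ) := hM₀ _ h1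
      _ = ((m + 1 : ℕ) : ℝ) * Real.log (1 + e / 4) := by
          push_cast
          field_simp
  obtain ⟨hexpU, hexpL⟩ := exp_le_pow_of_abs_le ha0 hgT
  rw [← hAdef] at hexpU hexpL
  -- the mass threshold `κ` and `k = κ^{m+1}`
  obtain ⟨κ, hκ⟩ : ∃ κ : ℝ, κ = e / (4 * max 1 (Real.exp (g t))) := ⟨_, rfl⟩
  have hmax1 : (1 : ℝ) ≤ max 1 (Real.exp (g t)) := le_max_left _ _
  have hmax2 : Real.exp (g t) ≤ max 1 (Real.exp (g t)) := le_max_right _ _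
  have hκ0 : 0 < κ := by rw [hκ]; positivity
  have hκe : κ ≤ e / 4 := by
    rw [hκ, div_le_div_iff₀ (by positivity) (by norm_num)]
    nlinarith
  have hκexp : Real.exp (g t) * κ ≤ e / 4 := by
    rw [hκ, mul_div_assoc', div_le_div_iff₀ (by positivity) (by norm_num)]
    nlinarith [he0.le, Real.exp_pos (g t)]
  obtain ⟨k, hk⟩ : ∃ k : ℝ, k = κ ^ (m + 1) := ⟨_, rfl⟩
  have hk0 : 0 < k := by rw [hk]; exact pow_pos hκ0 _
  have hk1 : k ≤ 1 := by rw [hk]; exact pow_le_one₀ hκ0.le (by linarith)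
  -- the small parameters
  obtain ⟨ε₅, hε₅⟩ : ∃ ε₅ : ℝ, ε₅ = e * k / 40 := ⟨_, rfl⟩
  have hε₅0 : 0 < ε₅ := by rw [hε₅]; positivity
  obtain ⟨η', hη'⟩ : ∃ η' : ℝ, η' = e * k / (40 * A * 5 ^ m) := ⟨_, rfl⟩
  have hη'0 : 0 < η' := by rw [hη']; positivity
  -- the size of the translate-constellations
  obtain ⟨L', hL'⟩ : ∃ L' : ℕ, L' = (3 * m + 1) * max L 1 := ⟨_, rfl⟩
  have hL'1 : (1 : ℝ) ≤ (L' : ℝ) := by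
    have h1 : 1 ≤ L' := by
      rw [hL']
      exact le_trans (le_max_right L 1) (Nat.le_mul_of_pos_left _ (Nat.succ_pos _))
    exact_mod_cast h1
  -- the degenerate count and the thresholds
  obtain ⟨C₀, hC₀⟩ := hD m t
  have hC0 : 0 ≤ max C₀ 0 := le_max_right _ _
  obtain ⟨N₂, hN₂⟩ := hA t L ht (e / 4) (by positivity)
  obtain ⟨N₃, hN₃⟩ := hSM m t L ht ε₅ hε₅0
  obtain ⟨N₁, hN₁⟩ := hA ((m + 1) * t) L' hT1 η' hη'0
  obtain ⟨N₄, hN₄⟩ := exists_degenerate_tail_le m ((m + 1) * t) hm1 hC0 hL'1 hε₅0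
  refine ⟨N₁ + N₂ + N₃ + N₄ + 1, fun N hN Ψ hΨ hL K hK hKN => ?_⟩
  have hNN₁ : N₁ ≤ N := by omega
  have hNN₂ : N₂ ≤ N := by omega
  have hNN₃ : N₃ ≤ N := by omega
  have hNN₄ : N₄ ≤ N := by omega
  have hN1 : 1 ≤ N := by omega
  have hN0 : (0 : ℝ) ≤ N := Nat.cast_nonneg N
  have hS0 : 0 ≤ vonMangoldtSum Ψ K N :=
    Theorems.LeeYangFibresRelativeDimOne.vonMangoldtSum_nonneg Ψ K N
  have hM0 : 0 ≤ archFactor Ψ K * singularProduct Ψ :=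
    mul_nonneg (archFactor_nonneg' Ψ K)
      (CellParityLaw.SectionAnnihilator.SingularRatio.singularProduct_nonneg hΨ)
  have heM : e * (archFactor Ψ K * singularProduct Ψ) ≤ ε * (archFactor Ψ K * singularProduct Ψ) :=
    mul_le_mul_of_nonneg_right heε hM0
  have heN : e * (N : ℝ) ≤ ε * N := mul_le_mul_of_nonneg_right heε hN0
  have heM0 : 0 ≤ e * (archFactor Ψ K * singularProduct Ψ) := mul_nonneg he0.le hM0
  have heN0 : 0 ≤ e * (N : ℝ) := mul_nonneg he0.le hN0
  rcases lt_or_ge (archFactor Ψ K * singularProduct Ψ) (κ * N) with hlow | hhigh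
  · -- LOW MASS: the atom at dimension `t` with slack `e/4`
    have h := (hN₂ N hNN₂ Ψ hΨ hL K hK hKN).1
    have h1 : Real.exp (g t) * (archFactor Ψ K * singularProduct Ψ) ≤ e / 4 * N :=
      calc Real.exp (g t) * (archFactor Ψ K * singularProduct Ψ)
          ≤ Real.exp (g t) * (κ * N) := mul_le_mul_of_nonneg_left hlow.le (Real.exp_pos _).le
        _ = Real.exp (g t) * κ * N := by ring
        _ ≤ e / 4 * N := mul_le_mul_of_nonneg_right hκexp hN0
    have h2 : archFactor Ψ K * singularProduct Ψ ≤ e / 4 * N :=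
      hlow.le.trans (mul_le_mul_of_nonneg_right hκe hN0)
    rw [abs_le]
    constructor <;> linarith
  · -- HIGH MASS: the tensor-power trick
    have hsize : ∀ H ∈ shiftBox m N, affLinSize (translateFamily Ψ H) N ≤ (L' : ℝ) := by
      intro H hH
      have h2 : (L : ℝ) ≤ ((max L 1 : ℕ) : ℝ) := by exact_mod_cast le_max_left L 1
      calc affLinSize (translateFamily Ψ H) N ≤ (3 * m + 1) * (L : ℝ) :=
            affLinSize_translateFamily_le hN1 hL hH
        _ ≤ (3 * m + 1) * ((max L 1 : ℕ) : ℝ) := mul_le_mul_of_nonneg_left h2 (by positivity)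
        _ = (L' : ℝ) := by rw [hL']; push_cast; ring
    have hkM : k * (N : ℝ) ^ (m + 1) ≤ (archFactor Ψ K * singularProduct Ψ) ^ (m + 1) := by
      rw [hk, ← mul_pow]
      exact pow_le_pow_left₀ (by positivity) hhigh _
    have hB0 : 0 ≤ (2 * (N : ℝ) + 1) * Real.log (2 * (L' : ℝ) * N) ^ ((m + 1) * t) := by
      have hN1r : (1 : ℝ) ≤ N := by exact_mod_cast hN1
      exact mul_nonneg (by positivity) (pow_nonneg (Real.log_nonneg (by nlinarith)) _)
    have key := high_mass_amplify (shiftBox m N)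
      (fun H => IsNondegenerateSystem (translateFamily Ψ H))
      (fun H => vonMangoldtSum (translateFamily Ψ H) (meetTranslates K H) N)
      (fun H => archFactor (translateFamily Ψ H) (meetTranslates K H) *
        singularProduct (translateFamily Ψ H))
      m hA1 he0.le he1 hS0 hM0 hk0.le hk1 hkM hε₅ hη' (hCS m t N Ψ K hKN)
      (hN₃ N hNN₃ Ψ hΨ hL K hK hKN)
      (fun H hH hnd => by
        have h := (hN₁ N hNN₁ (translateFamily Ψ H) hnd (hsize H hH) (meetTranslates K H)
          (convex_meetTranslates hK H) ((meetTranslates_subset K H).trans hKN)).1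
        have hMH : 0 ≤ archFactor (translateFamily Ψ H) (meetTranslates K H) *
            singularProduct (translateFamily Ψ H) :=
          mul_nonneg (archFactor_nonneg' _ _)
            (CellParityLaw.SectionAnnihilator.SingularRatio.singularProduct_nonneg hnd)
        have h2 := mul_le_mul_of_nonneg_right hexpU hMH
        show vonMangoldtSum (translateFamily Ψ H) (meetTranslates K H) N ≤
          A * (archFactor (translateFamily Ψ H) (meetTranslates K H) *
            singularProduct (translateFamily Ψ H)) + η' * N
        linarith)
      (fun H hH hnd => by
        have h := (hN₁ N hNN₁ (translateFamily Ψ H) hnd (hsize H hH) (meetTranslates K H)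
          (convex_meetTranslates hK H) ((meetTranslates_subset K H).trans hKN)).2
        have hMH : 0 ≤ archFactor (translateFamily Ψ H) (meetTranslates K H) *
            singularProduct (translateFamily Ψ H) :=
          mul_nonneg (archFactor_nonneg' _ _)
            (CellParityLaw.SectionAnnihilator.SingularRatio.singularProduct_nonneg hnd)
        have h2 := mul_le_mul_of_nonneg_right hexpL hMH
        show A⁻¹ * (archFactor (translateFamily Ψ H) (meetTranslates K H) *
            singularProduct (translateFamily Ψ H)) - η' * N ≤
          vonMangoldtSum (translateFamily Ψ H) (meetTranslates K H) N
        linarith)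
      (fun H hH _ => vonMangoldtSum_le_card_mul hN1 hL'1 (hsize H hH) (meetTranslates K H))
      hB0
      (fun H _ => Theorems.LeeYangFibresRelativeDimOne.vonMangoldtSum_nonneg _ _ _)
      (card_shiftBox_real_le m hN1)
      ((hC₀ N Ψ hΨ).trans (mul_le_mul_of_nonneg_right (le_max_left C₀ 0) (by positivity)))
      (hN₄ N hNN₄ hN1)
      (by rw [hAdef]; exact upper_ratio m e he0.le he1)
      (by rw [hAdef]; exact lower_ratio m he0.le he1)
    refine key.trans ?_
    nlinarith [mul_nonneg hε.le hN0]

end Summit.Parity.GeneralizedHardyLittlewood.Cruxes.RelativeDimOne.TranslateAmplification
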